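import Summits.NavierStokesRegularity.NavierStokesRegularity.Theorems.TypeICertificateLadderTargetFiveHalvesWindowDepletedSlice

/-!
# Crux `Target` (stmt-NavierStokesRegularity-1217), line `depletion-ladder` at `q = 5/2`: the
# TWO-PIECE depleted weighted `L^{5/2}` slice inequality (both Young steps global)

`--supports stmt-NavierStokesRegularity-1217`. `…DepletedSlice.lean` depletes the weighted Lamb
pairing `∫wt⟪(ω·∇)ω, v⟫` (constant `κ_A`) and keeps the pointwise Young absorption of the magnitude
pairing `∫τ⟪ω,(ω·∇)ω⟫⟪ω, v⟫` (`τ = wt/(2(|ω|²+1))`). Here the magnitude pairing is depleted too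
(constant `κ_B`; Cauchy–Schwarz `κ_B = 1` since `|τ⟪ω,(ω·∇)ω⟫⟪ω,v⟫| ≤ M·(√τ|ω|²)(√τ(Σ⟪ω,∂ᵢω⟫²)^{1/2})`)
and `τ|ω|⁴ ≤ wt|ω|²/2` gives `∫wt⟪ω, curl W⟫ ≤ ((2κ_A² + κ_B²)/(8ν))·M²·∫wt|ω|²`
(`depletedSlice_budgetAB`, `depletedSlice_curlAB`) — the slice form of the coefficient
`q(κ_A² + (q−2)κ_B²)/4` of `TypeICertificateLadderTargetDepletedBudgetReach.lean` at `q = 5/2`.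
[folklore: Young bookkeeping]
-/

noncomputable section

open Set Filter Topology MeasureTheory
open scoped RealInnerProductSpace ENNReal NNReal Laplacian ContDiff
open Literature.Analysis.FluidPDE

namespace Summit.NavierStokesRegularity.NavierStokesRegularity.Theorems.FiveHalvesWindow

-- the problem directory repeats the summit name (`NavierStokesRegularity/NavierStokesRegularity`)
set_option linter.dupNamespace false

open Summit.NavierStokesRegularity.NavierStokesRegularity.Theorems.RungReynoldsOne
open Summit.NavierStokesRegularity.NavierStokesRegularity.Theorems.RungReynoldsOne.WeightedSlice

/-- `τ‖y‖⁴ ≤ wt‖y‖²/2` (`wt = (‖y‖²+1)^{1/4}`, `τ = wt/(2(‖y‖²+1))`). [folklore] -/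
theorem tau_mul_pow_four_le (y : EuclideanSpace ℝ (Fin 3)) :
    (‖y‖ ^ 2 + 1) ^ (1 / 4 : ℝ) / (2 * (‖y‖ ^ 2 + 1)) * ‖y‖ ^ 4 ≤
      1 / 2 * ((‖y‖ ^ 2 + 1) ^ (1 / 4 : ℝ) * ‖y‖ ^ 2) := by
  have hwt0 : 0 ≤ (‖y‖ ^ 2 + 1) ^ (1 / 4 : ℝ) := Real.rpow_nonneg (by positivity) _
  have hρ : 0 < ‖y‖ ^ 2 + 1 := by positivity
  rw [div_mul_eq_mul_div, div_le_iff₀ (by positivity)]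
  have h1 : ‖y‖ ^ 4 ≤ ‖y‖ ^ 2 * (‖y‖ ^ 2 + 1) := by nlinarith [sq_nonneg ‖y‖]
  nlinarith [mul_le_mul_of_nonneg_left h1 hwt0]

/-- **The TWO-PIECE depleted weighted `L^{5/2}` budget for a solenoidal field** (hypotheses of
`weightedSlice_budget`, plus depletion of the weighted Lamb pairing with constant `κ` AND of the
magnitude pairing `∫ τ⟪w, Dw(w)⟫⟪w, v⟫`, `τ = wt/(2(‖w‖²+1))`, with constant `κB`):
`∫ (‖w‖²+1)^{1/4}⟪w, Z⟫ ≤ ((2κ²+κB²)/(8ν))·M²·∫(‖w‖²+1)^{1/4}‖w‖²` (both Young steps global;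
`κB = 1` is `depletedSlice_budget`). [folklore] -/
theorem depletedSlice_budgetAB {ν : ℝ} (hν : 0 < ν) {v w Z : EuclideanSpace ℝ (Fin 3) → EuclideanSpace ℝ (Fin 3)}
    (hv : ContDiff ℝ 1 v) (hw : ContDiff ℝ 3 w) (hdiv : VectorCalculus.IsDivFree v)
    (hdivw : ∀ x, VectorCalculus.divergence w x = 0)
    (hZ : ∀ x, Z x = ν • (Δ w) x - fderiv ℝ w x (v x) + fderiv ℝ v x (w x))
    {M B W₀ : ℝ} (hM : ∀ x, ‖v x‖ ≤ M) (hB : ∀ x, ‖fderiv ℝ v x‖ ≤ B)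
    (hwt : ∀ x, (‖w x‖ ^ 2 + 1) ^ (1 / 4 : ℝ) ≤ W₀)
    (l2w : ∫⁻ x, ‖w x‖ₑ ^ 2 < ⊤)
    (l2dw : ∀ i, ∫⁻ x, ‖fderiv ℝ w x (EuclideanSpace.basisFun (Fin 3) ℝ i)‖ₑ ^ 2 < ⊤)
    (l2ddw : ∀ i, ∫⁻ x, ‖fderiv ℝ (fun y => fderiv ℝ w y (EuclideanSpace.basisFun (Fin 3) ℝ i)) x
      (EuclideanSpace.basisFun (Fin 3) ℝ i)‖ₑ ^ 2 < ⊤)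
    {κ κB : ℝ}
    (hdep : |∫ x, (‖w x‖ ^ 2 + 1) ^ (1 / 4 : ℝ) * ⟪fderiv ℝ w x (w x), v x⟫| ≤
      κ * M * Real.sqrt (∫ x, (‖w x‖ ^ 2 + 1) ^ (1 / 4 : ℝ) * ‖w x‖ ^ 2) *
        Real.sqrt (∫ x, (‖w x‖ ^ 2 + 1) ^ (1 / 4 : ℝ) *
          ∑ i, ‖fderiv ℝ w x (EuclideanSpace.basisFun (Fin 3) ℝ i)‖ ^ 2))
    (hdepB : |∫ x, (‖w x‖ ^ 2 + 1) ^ (1 / 4 : ℝ) / (2 * (‖w x‖ ^ 2 + 1)) *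
        (⟪w x, fderiv ℝ w x (w x)⟫ * ⟪w x, v x⟫)| ≤
      κB * M * Real.sqrt (∫ x, (‖w x‖ ^ 2 + 1) ^ (1 / 4 : ℝ) / (2 * (‖w x‖ ^ 2 + 1)) * ‖w x‖ ^ 4) *
        Real.sqrt (∫ x, (‖w x‖ ^ 2 + 1) ^ (1 / 4 : ℝ) / (2 * (‖w x‖ ^ 2 + 1)) *
          ∑ i, ⟪w x, fderiv ℝ w x (EuclideanSpace.basisFun (Fin 3) ℝ i)⟫ ^ 2)) :
    ∫ x, (‖w x‖ ^ 2 + 1) ^ (1 / 4 : ℝ) * ⟪w x, Z x⟫ ≤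
      (2 * κ ^ 2 + κB ^ 2) / (8 * ν) * (M ^ 2 * ∫ x, (‖w x‖ ^ 2 + 1) ^ (1 / 4 : ℝ) * ‖w x‖ ^ 2) := by
  set e := EuclideanSpace.basisFun (Fin 3) ℝ with he
  have he1 : ∀ i, ‖e i‖ = 1 := fun i => by simp [he]
  have hw2 : ContDiff ℝ 2 w := hw.of_le (by norm_num)
  have hw1 : ContDiff ℝ 1 w := hw.of_le (by norm_num)
  have hdw : Differentiable ℝ w := hw2.differentiable two_ne_zero
  obtain ⟨iLap, iVisc, hVisc⟩ := weightedSlice_viscous hw hwt l2w l2dw l2ddw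
  obtain ⟨iTr, hTr⟩ := weightedSlice_transport hv hw2 hdiv hM hB hwt l2w l2dw
  obtain ⟨iStr0, iStr, hStr⟩ := weightedSlice_stretching hv hw2 hdivw hM hB hwt l2w l2dw
  have hM0 : 0 ≤ M := (norm_nonneg _).trans (hM 0)
  have hW0 : 0 ≤ W₀ := (Real.rpow_nonneg (by positivity) _).trans (hwt 0)
  have cv : Continuous v := hv.continuous
  have cw : Continuous w := hw.continuous
  have cDw : Continuous (fderiv ℝ w) := hw1.continuous_fderiv one_ne_zero
  have cDwe : ∀ i, Continuous fun x => fderiv ℝ w x (e i) := fun i =>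
    cDw.clm_apply continuous_const
  have cwt : Continuous fun x => (‖w x‖ ^ 2 + 1) ^ (1 / 4 : ℝ) :=
    ((cw.norm.pow 2).add continuous_const).rpow_const fun x => Or.inr (by norm_num)
  have cτ : Continuous fun x => (‖w x‖ ^ 2 + 1) ^ (1 / 4 : ℝ) / (2 * (‖w x‖ ^ 2 + 1)) :=
    cwt.div (continuous_const.mul ((cw.norm.pow 2).add continuous_const)) fun x => by positivity
  have hwt0 : ∀ x, 0 ≤ (‖w x‖ ^ 2 + 1) ^ (1 / 4 : ℝ) := fun x => Real.rpow_nonneg (by positivity) _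
  set fA : EuclideanSpace ℝ (Fin 3) → ℝ := fun x =>
    (‖w x‖ ^ 2 + 1) ^ (1 / 4 : ℝ) * ∑ i, ‖fderiv ℝ w x (e i)‖ ^ 2 with hfA
  set fS : EuclideanSpace ℝ (Fin 3) → ℝ := fun x =>
    (‖w x‖ ^ 2 + 1) ^ (1 / 4 : ℝ) / (2 * (‖w x‖ ^ 2 + 1)) * ∑ i, ⟪w x, fderiv ℝ w x (e i)⟫ ^ 2
    with hfS
  set fX : EuclideanSpace ℝ (Fin 3) → ℝ := fun x =>
    (‖w x‖ ^ 2 + 1) ^ (1 / 4 : ℝ) * ⟪fderiv ℝ w x (w x), v x⟫ with hfX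
  set fYZ : EuclideanSpace ℝ (Fin 3) → ℝ := fun x =>
    (‖w x‖ ^ 2 + 1) ^ (1 / 4 : ℝ) / (2 * (‖w x‖ ^ 2 + 1)) *
      (⟪w x, fderiv ℝ w x (w x)⟫ * ⟪w x, v x⟫) with hfYZ
  have hvisc_pt : ∀ x, ∑ i, ⟪fderiv ℝ w x (e i),
      fderiv ℝ (fun y => (‖w y‖ ^ 2 + 1) ^ (1 / 4 : ℝ) • w y) x (e i)⟫ = fA x + fS x := by
    intro x
    simp_rw [fderiv_weightedField_apply (hdw x)]
    exact visc_density_eq (fderiv ℝ w x) (w x) _ _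
  have hstr_pt : ∀ x, ⟪fderiv ℝ (fun y => (‖w y‖ ^ 2 + 1) ^ (1 / 4 : ℝ) • w y) x (w x), v x⟫ =
      fX x + fYZ x := by
    intro x
    rw [fderiv_weightedField_apply (hdw x)]
    exact str_density_eq (fderiv ℝ w x) (w x) (v x) _ _
  have isq : ∀ i, Integrable (fun x => ‖fderiv ℝ w x (e i)‖ ^ 2) volume := fun i =>
    integrable_sq_norm_of_lintegral_lt_top (cDwe i) (l2dw i)
  have iA : Integrable fA volume := by
    have isum : Integrable (fun x => ∑ i, ‖fderiv ℝ w x (e i)‖ ^ 2) volume :=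
      integrable_finsetSum _ fun i _ => isq i
    refine Integrable.mono' (isum.const_mul W₀) (cwt.mul (continuous_finsetSum _ fun i _ =>
      (cDwe i).norm.pow 2)).aestronglyMeasurable (Eventually.of_forall fun x => ?_)
    have hs0 : 0 ≤ ∑ i, ‖fderiv ℝ w x (e i)‖ ^ 2 := Finset.sum_nonneg fun i _ => sq_nonneg _
    rw [hfA]
    simp only
    rw [Real.norm_of_nonneg (mul_nonneg (hwt0 x) hs0)]
    exact mul_le_mul_of_nonneg_right (hwt x) hs0
  have iS : Integrable fS volume := by
    have h := iVisc.sub iA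
    refine h.congr (Eventually.of_forall fun x => ?_)
    simp only [Pi.sub_apply]
    rw [hvisc_pt x]
    ring
  have iX : Integrable fX volume := by
    -- `|fX| ≤ Σᵢ W₀ M ‖w‖ ‖∂ᵢw‖`, each summand a product of two `L²` functions
    have ib : ∀ i, Integrable (fun x => W₀ * M * (‖w x‖ * ‖fderiv ℝ w x (e i)‖)) volume := by
      intro i
      refine integrable_of_norm_le_const_mul_mul (W₀ * M) ?_ cw (cDwe i) l2w (l2dw i) fun x => ?_
      · exact continuous_const.mul (cw.norm.mul (cDwe i).norm)
      · rw [Real.norm_of_nonneg (by positivity)]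
        ring_nf
        rfl
    have isum : Integrable (fun x => ∑ i, W₀ * M * (‖w x‖ * ‖fderiv ℝ w x (e i)‖)) volume :=
      integrable_finsetSum _ fun i _ => ib i
    refine Integrable.mono' isum ((cwt.mul ((cDw.clm_apply cw).inner cv))).aestronglyMeasurable
      (Eventually.of_forall fun x => ?_)
    rw [hfX]
    simp only
    rw [norm_mul, Real.norm_of_nonneg (hwt0 x)]
    -- `‖Dw(w)‖ ≤ Σᵢ |wᵢ| ‖Dw eᵢ‖ ≤ ‖w‖ Σᵢ ‖Dw eᵢ‖`
    have hLy : fderiv ℝ w x (w x) = ∑ i, ⟪e i, w x⟫ • fderiv ℝ w x (e i) := by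
      conv_lhs => rw [← e.sum_repr' (w x)]
      rw [map_sum]
      simp_rw [map_smul]
    have hnorm : ‖fderiv ℝ w x (w x)‖ ≤ ∑ i, ‖w x‖ * ‖fderiv ℝ w x (e i)‖ := by
      rw [hLy]
      refine (norm_sum_le _ _).trans (Finset.sum_le_sum fun i _ => ?_)
      rw [norm_smul]
      refine mul_le_mul_of_nonneg_right ?_ (norm_nonneg _)
      have := abs_real_inner_le_norm (e i) (w x)
      rw [he1, one_mul] at this
      exact this
    have hin : ‖⟪fderiv ℝ w x (w x), v x⟫‖ ≤ ‖fderiv ℝ w x (w x)‖ * M :=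
      (norm_inner_le_norm _ _).trans (mul_le_mul_of_nonneg_left (hM x) (norm_nonneg _))
    calc (‖w x‖ ^ 2 + 1) ^ (1 / 4 : ℝ) * ‖⟪fderiv ℝ w x (w x), v x⟫‖
        ≤ W₀ * ((∑ i, ‖w x‖ * ‖fderiv ℝ w x (e i)‖) * M) := by
          refine mul_le_mul (hwt x) (hin.trans ?_) (norm_nonneg _) hW0
          exact mul_le_mul_of_nonneg_right hnorm hM0
      _ = ∑ i, W₀ * M * (‖w x‖ * ‖fderiv ℝ w x (e i)‖) := by
          rw [Finset.sum_mul, Finset.mul_sum]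
          refine Finset.sum_congr rfl fun i _ => ?_
          ring
  have iYZ : Integrable fYZ volume := by
    have h := iStr.sub iX
    refine h.congr (Eventually.of_forall fun x => ?_)
    simp only [Pi.sub_apply]
    rw [hstr_pt x]
    ring
  have iwsq : Integrable (fun x => (‖w x‖ ^ 2 + 1) ^ (1 / 4 : ℝ) * ‖w x‖ ^ 2) volume := by
    have isqw : Integrable (fun x => ‖w x‖ ^ 2) volume := integrable_sq_norm_of_lintegral_lt_top cw l2w
    refine Integrable.mono' (isqw.const_mul W₀) (cwt.mul (cw.norm.pow 2)).aestronglyMeasurable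
      (Eventually.of_forall fun x => ?_)
    rw [Real.norm_of_nonneg (mul_nonneg (hwt0 x) (sq_nonneg _))]
    exact mul_le_mul_of_nonneg_right (hwt x) (sq_nonneg _)
  set D : ℝ := ∫ x, fA x with hD
  set Y : ℝ := ∫ x, (‖w x‖ ^ 2 + 1) ^ (1 / 4 : ℝ) * ‖w x‖ ^ 2 with hY
  have hD0 : 0 ≤ D := integral_nonneg fun x => mul_nonneg (hwt0 x)
    (Finset.sum_nonneg fun i _ => sq_nonneg _)
  have hY0 : 0 ≤ Y := integral_nonneg fun x => mul_nonneg (hwt0 x) (sq_nonneg _)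
  have hfun : (fun x => (‖w x‖ ^ 2 + 1) ^ (1 / 4 : ℝ) * ⟪w x, Z x⟫) = fun x =>
      ν * ⟪(Δ w) x, (‖w x‖ ^ 2 + 1) ^ (1 / 4 : ℝ) • w x⟫ -
        (‖w x‖ ^ 2 + 1) ^ (1 / 4 : ℝ) * ⟪w x, fderiv ℝ w x (v x)⟫ +
        (‖w x‖ ^ 2 + 1) ^ (1 / 4 : ℝ) * ⟪w x, fderiv ℝ v x (w x)⟫ := by
    funext x
    have hc : ⟪(Δ w) x, (‖w x‖ ^ 2 + 1) ^ (1 / 4 : ℝ) • w x⟫ =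
        (‖w x‖ ^ 2 + 1) ^ (1 / 4 : ℝ) * ⟪w x, (Δ w) x⟫ := by
      rw [real_inner_smul_right, real_inner_comm]
    rw [hc, hZ x]
    simp only [inner_add_right, inner_sub_right, real_inner_smul_right]
    ring
  have iAB : Integrable (fun x => ν * ⟪(Δ w) x, (‖w x‖ ^ 2 + 1) ^ (1 / 4 : ℝ) • w x⟫ -
      (‖w x‖ ^ 2 + 1) ^ (1 / 4 : ℝ) * ⟪w x, fderiv ℝ w x (v x)⟫) volume :=
    (iLap.const_mul ν).sub iTr
  rw [hfun, integral_add iAB iStr0, integral_sub (iLap.const_mul ν) iTr,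
    integral_const_mul, hVisc, hTr, hStr, sub_zero]
  have hViscSplit : ∫ x, ∑ i, ⟪fderiv ℝ w x (e i),
      fderiv ℝ (fun y => (‖w y‖ ^ 2 + 1) ^ (1 / 4 : ℝ) • w y) x (e i)⟫ = D + ∫ x, fS x := by
    rw [hD, ← integral_add iA iS]
    exact integral_congr_ae (Eventually.of_forall hvisc_pt)
  have hStrSplit : ∫ x, ⟪fderiv ℝ (fun y => (‖w y‖ ^ 2 + 1) ^ (1 / 4 : ℝ) • w y) x (w x), v x⟫ =
      (∫ x, fX x) + ∫ x, fYZ x := by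
    rw [← integral_add iX iYZ]
    exact integral_congr_ae (Eventually.of_forall hstr_pt)
  rw [hViscSplit, hStrSplit]
  -- piece A: global Young from the depletion hypothesis
  have hApiece : -(ν * D) - ∫ x, fX x ≤ κ ^ 2 * M ^ 2 * Y / (4 * ν) := by
    have habs : -(∫ x, fX x) ≤ κ * M * Real.sqrt Y * Real.sqrt D := by
      have h1 := neg_le_abs (∫ x, fX x)
      have h2 : |∫ x, fX x| ≤ κ * M * Real.sqrt Y * Real.sqrt D := hdep
      linarith
    have hq := neg_mul_sq_add_mul_le hν (Real.sqrt D) (κ * M * Real.sqrt Y)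
    rw [Real.sq_sqrt hD0] at hq
    have hsq : (κ * M * Real.sqrt Y) ^ 2 = κ ^ 2 * M ^ 2 * Y := by
      rw [mul_pow, mul_pow, Real.sq_sqrt hY0]
    rw [hsq] at hq
    nlinarith [hq, habs]
  -- piece B: global Young from the second depletion hypothesis, then `τ‖w‖⁴ ≤ wt‖w‖²/2`
  have hτ0 : ∀ x, 0 ≤ (‖w x‖ ^ 2 + 1) ^ (1 / 4 : ℝ) / (2 * (‖w x‖ ^ 2 + 1)) := fun x => by
    have := hwt0 x; positivity
  have hS0 : 0 ≤ ∫ x, fS x := integral_nonneg fun x => mul_nonneg (hτ0 x)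
    (Finset.sum_nonneg fun i _ => sq_nonneg _)
  have i4 : Integrable (fun x => (‖w x‖ ^ 2 + 1) ^ (1 / 4 : ℝ) / (2 * (‖w x‖ ^ 2 + 1)) * ‖w x‖ ^ 4)
      volume := by
    refine Integrable.mono' (iwsq.const_mul (1 / 2)) ((cτ.mul (cw.norm.pow 4))).aestronglyMeasurable
      (Eventually.of_forall fun x => ?_)
    rw [Real.norm_of_nonneg (mul_nonneg (hτ0 x) (by positivity))]
    exact tau_mul_pow_four_le (w x)
  have hI4 : ∫ x, (‖w x‖ ^ 2 + 1) ^ (1 / 4 : ℝ) / (2 * (‖w x‖ ^ 2 + 1)) * ‖w x‖ ^ 4 ≤ 1 / 2 * Y := by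
    rw [hY, ← integral_const_mul]
    exact integral_mono i4 (iwsq.const_mul _) fun x => tau_mul_pow_four_le (w x)
  have hI40 : 0 ≤ ∫ x, (‖w x‖ ^ 2 + 1) ^ (1 / 4 : ℝ) / (2 * (‖w x‖ ^ 2 + 1)) * ‖w x‖ ^ 4 :=
    integral_nonneg fun x => mul_nonneg (hτ0 x) (by positivity)
  have hBpiece : -(ν * ∫ x, fS x) - ∫ x, fYZ x ≤ 1 / (8 * ν) * (κB ^ 2 * (M ^ 2 * Y)) := by
    set I4 : ℝ := ∫ x, (‖w x‖ ^ 2 + 1) ^ (1 / 4 : ℝ) / (2 * (‖w x‖ ^ 2 + 1)) * ‖w x‖ ^ 4 with hI4def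
    have habs : -(∫ x, fYZ x) ≤ κB * M * Real.sqrt I4 * Real.sqrt (∫ x, fS x) := by
      have h1 := neg_le_abs (∫ x, fYZ x)
      have h2 : |∫ x, fYZ x| ≤ κB * M * Real.sqrt I4 * Real.sqrt (∫ x, fS x) := hdepB
      linarith
    have hq := neg_mul_sq_add_mul_le hν (Real.sqrt (∫ x, fS x)) (κB * M * Real.sqrt I4)
    rw [Real.sq_sqrt hS0] at hq
    have hsq : (κB * M * Real.sqrt I4) ^ 2 = κB ^ 2 * M ^ 2 * I4 := by
      rw [mul_pow, mul_pow, Real.sq_sqrt hI40]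
    rw [hsq] at hq
    have hI4' : κB ^ 2 * M ^ 2 * I4 / (4 * ν) ≤ 1 / (8 * ν) * (κB ^ 2 * (M ^ 2 * Y)) := by
      have hk : 0 ≤ κB ^ 2 * M ^ 2 := by positivity
      have := mul_le_mul_of_nonneg_left hI4 hk
      have hν4 : 0 < 4 * ν := by positivity
      rw [div_le_iff₀ hν4]
      have e : 1 / (8 * ν) * (κB ^ 2 * (M ^ 2 * Y)) * (4 * ν) = κB ^ 2 * M ^ 2 * (1 / 2 * Y) := by
        field_simp; ring
      rw [e]; exact this
    nlinarith [hq, habs, hI4']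
  have e2 : (2 * κ ^ 2 + κB ^ 2) / (8 * ν) * (M ^ 2 * Y) =
      κ ^ 2 * M ^ 2 * Y / (4 * ν) + 1 / (8 * ν) * (κB ^ 2 * (M ^ 2 * Y)) := by
    field_simp
    ring
  rw [e2]
  have e3 : ν * -(D + ∫ x, fS x) + -((∫ x, fX x) + ∫ x, fYZ x) =
      (-(ν * D) - ∫ x, fX x) + (-(ν * ∫ x, fS x) - ∫ x, fYZ x) := by ring
  rw [e3]
  exact add_le_add hApiece hBpiece

/-- **The two-piece depleted slice for `ω = curl v`**: with depletion instances for both pairings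
(constants `κ`, `κB`), `∫(|ω|²+1)^{1/4}⟪ω, curl W⟫ ≤ (c/ν)·M²·∫(|ω|²+1)^{1/4}|ω|²` for every
`c ≥ (2κ²+κB²)/8`. [folklore] -/
theorem depletedSlice_curlAB {ν : ℝ} (hν : 0 < ν) {κ κB c : ℝ} (hc : (2 * κ ^ 2 + κB ^ 2) / 8 ≤ c)
    {v W : EuclideanSpace ℝ (Fin 3) → EuclideanSpace ℝ (Fin 3)}
    (hv : ContDiff ℝ ∞ v) (hdiv : VectorCalculus.IsDivFree v)
    (hcurl : ∀ x, curl W x = ν • (Δ (curl v)) x - convect v (curl v) x + convect (curl v) v x)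
    {M B : ℝ} (hM : ∀ x, ‖v x‖ ≤ M) (hB : ∀ x, ‖fderiv ℝ v x‖ ≤ B)
    (h1 : ∫⁻ x, ‖iteratedFDeriv ℝ 1 v x‖ₑ ^ 2 < ⊤) (h2 : ∫⁻ x, ‖iteratedFDeriv ℝ 2 v x‖ₑ ^ 2 < ⊤)
    (h3 : ∫⁻ x, ‖iteratedFDeriv ℝ 3 v x‖ₑ ^ 2 < ⊤)
    (hdep : |∫ x, (‖curl v x‖ ^ 2 + 1) ^ (1 / 4 : ℝ) * ⟪fderiv ℝ (curl v) x (curl v x), v x⟫| ≤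
      κ * M * Real.sqrt (∫ x, (‖curl v x‖ ^ 2 + 1) ^ (1 / 4 : ℝ) * ‖curl v x‖ ^ 2) *
        Real.sqrt (∫ x, (‖curl v x‖ ^ 2 + 1) ^ (1 / 4 : ℝ) *
          ∑ i, ‖fderiv ℝ (curl v) x (EuclideanSpace.basisFun (Fin 3) ℝ i)‖ ^ 2))
    (hdepB : |∫ x, (‖curl v x‖ ^ 2 + 1) ^ (1 / 4 : ℝ) / (2 * (‖curl v x‖ ^ 2 + 1)) *
        (⟪curl v x, fderiv ℝ (curl v) x (curl v x)⟫ * ⟪curl v x, v x⟫)| ≤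
      κB * M * Real.sqrt (∫ x, (‖curl v x‖ ^ 2 + 1) ^ (1 / 4 : ℝ) / (2 * (‖curl v x‖ ^ 2 + 1)) *
          ‖curl v x‖ ^ 4) *
        Real.sqrt (∫ x, (‖curl v x‖ ^ 2 + 1) ^ (1 / 4 : ℝ) / (2 * (‖curl v x‖ ^ 2 + 1)) *
          ∑ i, ⟪curl v x, fderiv ℝ (curl v) x (EuclideanSpace.basisFun (Fin 3) ℝ i)⟫ ^ 2)) :
    ∫ x, (‖curl v x‖ ^ 2 + 1) ^ (1 / 4 : ℝ) * ⟪curl v x, curl W x⟫ ≤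
      c / ν * (M ^ 2 * ∫ x, (‖curl v x‖ ^ 2 + 1) ^ (1 / 4 : ℝ) * ‖curl v x‖ ^ 2) := by
  set e := EuclideanSpace.basisFun (Fin 3) ℝ with he
  have he1 : ∀ i, ‖e i‖ = 1 := fun i => by simp [he]
  have hDv : ContDiff ℝ ∞ (fderiv ℝ v) := (contDiff_infty_iff_fderiv.1 hv).2
  have hω : ContDiff ℝ ∞ (curl v) := by
    rw [curl_eq_curlCLM_comp]
    exact curlCLM.contDiff.comp hDv
  have hω3 : ContDiff ℝ 3 (curl v) := hω.of_le (by norm_cast)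
  have hω2 : ContDiff ℝ 2 (curl v) := hω.of_le (by norm_cast)
  have hv1 : ContDiff ℝ 1 v := hv.of_le (by norm_cast)
  have hv2 : ContDiff ℝ 2 v := hv.of_le (by norm_cast)
  have hdivω : ∀ x, VectorCalculus.divergence (curl v) x = 0 := fun x =>
    divergence_curl_eq_zero_holds v hv2 x
  have hZ : ∀ x, curl W x =
      ν • (Δ (curl v)) x - fderiv ℝ (curl v) x (v x) + fderiv ℝ v x (curl v x) := hcurl
  have nω : ∀ x, ‖curl v x‖ ≤ ‖curlCLM‖ * B := fun x =>
    (norm_curl_le v x).trans (mul_le_mul_of_nonneg_left (hB x) (norm_nonneg curlCLM))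
  have hwt : ∀ x, (‖curl v x‖ ^ 2 + 1) ^ (1 / 4 : ℝ) ≤ (‖curlCLM‖ * B) ^ 2 + 1 := fun x =>
    (weight_le (curl v x)).trans (by
      have := pow_le_pow_left₀ (norm_nonneg _) (nω x) 2
      linarith)
  have l2ω : ∫⁻ x, ‖curl v x‖ₑ ^ 2 < ⊤ := by
    refine lintegral_enorm_sq_lt_top_of_norm_le_const_mul ‖curlCLM‖ (fun x => ?_) h1
    rw [← norm_iteratedFDeriv_fderiv, norm_iteratedFDeriv_zero]
    exact norm_curl_le v x
  have l2dω : ∀ i, ∫⁻ x, ‖fderiv ℝ (curl v) x (e i)‖ₑ ^ 2 < ⊤ := fun i => by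
    refine lintegral_enorm_sq_lt_top_of_norm_le_const_mul ‖curlCLM‖ (fun x => ?_) h2
    calc ‖fderiv ℝ (curl v) x (e i)‖ ≤ ‖fderiv ℝ (curl v) x‖ := by
          simpa [he1] using (fderiv ℝ (curl v) x).le_opNorm (e i)
      _ ≤ ‖curlCLM‖ * ‖iteratedFDeriv ℝ 2 v x‖ := norm_fderiv_curl_le hv2 x
  have l2ddω : ∀ i, ∫⁻ x, ‖fderiv ℝ (fun y => fderiv ℝ (curl v) y (e i)) x (e i)‖ₑ ^ 2 < ⊤ :=
      fun i => by
    refine lintegral_enorm_sq_lt_top_of_norm_le_const_mul ‖curlCLM‖ (fun x => ?_) h3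
    calc ‖fderiv ℝ (fun y => fderiv ℝ (curl v) y (e i)) x (e i)‖
        ≤ ‖iteratedFDeriv ℝ 2 (curl v) x‖ := norm_fderiv_fderiv_apply_basisFun_le hω2 x i
      _ ≤ ‖curlCLM‖ * ‖iteratedFDeriv ℝ 3 v x‖ := by
          rw [curl_eq_curlCLM_comp, curlCLM.iteratedFDeriv_comp_left (hDv.contDiffAt (x := x))
            (i := 2) (by norm_cast), ← norm_iteratedFDeriv_fderiv]
          exact ContinuousLinearMap.norm_compContinuousMultilinearMap_le _ _
  have hY0 : 0 ≤ ∫ x, (‖curl v x‖ ^ 2 + 1) ^ (1 / 4 : ℝ) * ‖curl v x‖ ^ 2 :=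
    integral_nonneg fun x => mul_nonneg (Real.rpow_nonneg (by positivity) _) (sq_nonneg _)
  have hmain := depletedSlice_budgetAB hν hv1 hω3 hdiv hdivω hZ hM hB hwt l2ω l2dω l2ddω hdep hdepB
  refine hmain.trans ?_
  have h1 : (2 * κ ^ 2 + κB ^ 2) / (8 * ν) = (2 * κ ^ 2 + κB ^ 2) / 8 / ν := by rw [div_div]
  rw [h1]
  exact mul_le_mul_of_nonneg_right (div_le_div_of_nonneg_right hc hν.le) (by positivity)

end Summit.NavierStokesRegularity.NavierStokesRegularity.Theorems.FiveHalvesWindow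

end
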